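import Summits.AnomalousDissipation.AnomalousDissipation.Theorems.SawtoothPulseCascadeK1LocalisedCascadeSlotEvolution

/-!
# K1loc, line `Spectral` / SeqCone — helper: TOOLS FOR THE SLOT LEMMA (comparison lemma, Cauchy–Schwarz in time,
# `L²` bookkeeping of the localised field)

Fifth S3b helper file of the prover lane on the crux `K1LocalisedCascade` (stmt-AnomalousDissipation-19491), route
`SawtoothPulseCascade` (architecture note `K1loc-architecture-findings-k1locp1.md`, F-b):
* `sqrt_le_of_hasDerivWithinAt_le` — if `q ≥ 0` has `q' ≤ 2κ(√q·a + r)` within `[t₀,t₁]` (`q', a, r` continuous,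
  `a, r ≥ 0`) then `√q(t₁) ≤ √q(t₀) + 2κ∫a + √(2κ∫r)` (maximise `q`, integrate, solve the quadratic inequality);
* `sq_intervalIntegral_le` — `(∫g)² ≤ (t₁−t₀)∫g²`;
* `integral_moved_sq_eq` — `∫(G_t)² = ‖θ(t)‖²` for the pull-back; `integral_loc_sq_le` — for `F = X(x_j)·G`,
  `|X| ≤ 1`, `|X'| ≤ C₁`, `|c| ≤ γ`, slope floor: `∫(∂ᵢF)² ≤ ∫(∂ᵢG)²` and
  `∫(∂ⱼF − cσ∂ᵢF)² ≤ 3(∫(D̄G)² + C₁²∫G² + γ²ε₁²∫(∂ᵢG)²)`.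
WHAT THIS IS NOT: no statement about the cascade or the stub itself; no definitions.
[cite: BedrossianCotiZelati2017, §2 (energy method in shear coordinates)] [problem: turb]
-/

-- `Summit.<Summit>.<Problem>`: single-conjunct summit, the duplicate namespace segment is deliberate.
set_option linter.dupNamespace false

noncomputable section

namespace Summit.AnomalousDissipation.AnomalousDissipation.Theorems.SawtoothPulseCascade.K1Slot

open MeasureTheory Set Filter Topology UnitAddTorus Function
open scoped ContDiff InnerProductSpace
open Literature.Analysis Literature.Analysis.FunctionSpaces Literature.Analysis.FunctionSpaces.Torus
open Literature.Analysis.FluidPDE.ShearStage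

-- BODY

section SlotLemma

open scoped ComplexConjugate

variable {i j : Fin 2}

/-! ## §1 Two real-variable lemmas -/

/-- **Comparison lemma.** If `q ≥ 0` is differentiable within `[t₀,t₁]` with `q' ≤ 2κ(√q·a + r)`, `q'`, `a`, `r`
continuous and `a, r ≥ 0`, then `√q(t₁) ≤ √q(t₀) + 2κ∫a + √(2κ∫r)` (maximise `q` over the interval and integrate).
[folklore] -/
theorem sqrt_le_of_hasDerivWithinAt_le {q q' a r : ℝ → ℝ} {t₀ t₁ κ : ℝ} (ht : t₀ ≤ t₁) (hκ : 0 ≤ κ)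
    (hq : ∀ t ∈ Icc t₀ t₁, HasDerivWithinAt q (q' t) (Icc t₀ t₁) t) (hq'c : ContinuousOn q' (Icc t₀ t₁))
    (hq0 : ∀ t ∈ Icc t₀ t₁, 0 ≤ q t) (hb : ∀ t ∈ Icc t₀ t₁, q' t ≤ 2 * κ * (Real.sqrt (q t) * a t + r t))
    (ha : ContinuousOn a (Icc t₀ t₁)) (hr : ContinuousOn r (Icc t₀ t₁)) (ha0 : ∀ t ∈ Icc t₀ t₁, 0 ≤ a t)
    (hr0 : ∀ t ∈ Icc t₀ t₁, 0 ≤ r t) :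
    Real.sqrt (q t₁) ≤ Real.sqrt (q t₀) + 2 * κ * (∫ t in t₀..t₁, a t) + Real.sqrt (2 * κ * ∫ t in t₀..t₁, r t) := by
  have hqc : ContinuousOn q (Icc t₀ t₁) := fun t htI => (hq t htI).continuousWithinAt
  obtain ⟨s, hs, hmax⟩ := (isCompact_Icc : IsCompact (Icc t₀ t₁)).exists_isMaxOn (nonempty_Icc.2 ht) hqc
  set M := Real.sqrt (q s) with hM
  have hM0 : 0 ≤ M := Real.sqrt_nonneg _
  have hle : ∀ t ∈ Icc t₀ t₁, Real.sqrt (q t) ≤ M := fun t htI => Real.sqrt_le_sqrt (hmax htI)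
  -- integrate `q' ≤ 2κ(M a + r)` on `[t₀, s]`
  have hsub : Icc t₀ s ⊆ Icc t₀ t₁ := Icc_subset_Icc le_rfl hs.2
  have hIa : IntervalIntegrable a volume t₀ t₁ := (ha.mono (by rw [uIcc_of_le ht])).intervalIntegrable
  have hIr : IntervalIntegrable r volume t₀ t₁ := (hr.mono (by rw [uIcc_of_le ht])).intervalIntegrable
  have hIas : IntervalIntegrable a volume t₀ s := (ha.mono (by rw [uIcc_of_le hs.1]; exact hsub)).intervalIntegrable
  have hIrs : IntervalIntegrable r volume t₀ s := (hr.mono (by rw [uIcc_of_le hs.1]; exact hsub)).intervalIntegrable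
  have hIq' : IntervalIntegrable q' volume t₀ s := (hq'c.mono (by rw [uIcc_of_le hs.1]; exact hsub)).intervalIntegrable
  have hFTC : ∫ t in t₀..s, q' t = q s - q t₀ :=
    intervalIntegral.integral_eq_sub_of_hasDerivAt_of_le hs.1 (hqc.mono hsub)
      (fun t htI => ((hq t (hsub (Ioo_subset_Icc_self htI))).mono hsub).hasDerivAt
        (Icc_mem_nhds htI.1 htI.2)) hIq'
  have hmono : ∫ t in t₀..s, q' t ≤ ∫ t in t₀..s, 2 * κ * (M * a t + r t) := by
    refine intervalIntegral.integral_mono_on hs.1 hIq' ((hIas.const_mul M).add hIrs |>.const_mul _) fun t htI => ?_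
    have htI' := hsub htI
    refine (hb t htI').trans ?_
    gcongr
    · exact hq0 t htI' |> fun _ => ha0 t htI'
    · exact hle t htI'
  have hsplit : ∫ t in t₀..s, 2 * κ * (M * a t + r t) = 2 * κ * (M * ∫ t in t₀..s, a t) + 2 * κ * ∫ t in t₀..s, r t := by
    rw [intervalIntegral.integral_const_mul, intervalIntegral.integral_add (hIas.const_mul M) hIrs,
      intervalIntegral.integral_const_mul]
    ring
  -- compare partial integrals with full ones
  have hIa_le : ∫ t in t₀..s, a t ≤ ∫ t in t₀..t₁, a t := by
    have hadd := intervalIntegral.integral_add_adjacent_intervals hIas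
      ((ha.mono (by rw [uIcc_of_le hs.2]; exact Icc_subset_Icc hs.1 le_rfl)).intervalIntegrable)
    have hnn : 0 ≤ ∫ t in s..t₁, a t :=
      intervalIntegral.integral_nonneg hs.2 fun t htI => ha0 t (Icc_subset_Icc hs.1 le_rfl htI)
    linarith
  have hIr_le : ∫ t in t₀..s, r t ≤ ∫ t in t₀..t₁, r t := by
    have hadd := intervalIntegral.integral_add_adjacent_intervals hIrs
      ((hr.mono (by rw [uIcc_of_le hs.2]; exact Icc_subset_Icc hs.1 le_rfl)).intervalIntegrable)
    have hnn : 0 ≤ ∫ t in s..t₁, r t :=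
      intervalIntegral.integral_nonneg hs.2 fun t htI => hr0 t (Icc_subset_Icc hs.1 le_rfl htI)
    linarith
  set Ia := ∫ t in t₀..t₁, a t with hIa_def
  set Ir := ∫ t in t₀..t₁, r t with hIr_def
  have hIa0 : 0 ≤ Ia := intervalIntegral.integral_nonneg ht fun t htI => ha0 t htI
  have hIr0 : 0 ≤ Ir := intervalIntegral.integral_nonneg ht fun t htI => hr0 t htI
  -- `M² ≤ q(t₀) + 2κ M Ia + 2κ Ir`
  have hq0s : 0 ≤ q s := hq0 s hs
  have hkey : M * M ≤ q t₀ + 2 * κ * M * Ia + 2 * κ * Ir := by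
    rw [hM, Real.mul_self_sqrt hq0s]
    have h1 : q s - q t₀ ≤ 2 * κ * (M * ∫ t in t₀..s, a t) + 2 * κ * ∫ t in t₀..s, r t := by
      rw [← hFTC]; exact hmono.trans_eq hsplit
    have h2 : 2 * κ * (M * ∫ t in t₀..s, a t) ≤ 2 * κ * (M * Ia) :=
      mul_le_mul_of_nonneg_left (mul_le_mul_of_nonneg_left hIa_le hM0) (by positivity)
    have h3 : 2 * κ * ∫ t in t₀..s, r t ≤ 2 * κ * Ir := mul_le_mul_of_nonneg_left hIr_le (by positivity)
    linarith
  -- elementary: `M ≤ √q(t₀) + 2κ Ia + √(2κ Ir)`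
  set B := Real.sqrt (q t₀) + Real.sqrt (2 * κ * Ir) with hB
  have hB0 : 0 ≤ B := add_nonneg (Real.sqrt_nonneg _) (Real.sqrt_nonneg _)
  have hBsq : q t₀ + 2 * κ * Ir ≤ B * B := by
    rw [hB]
    nlinarith [Real.mul_self_sqrt (hq0 t₀ (left_mem_Icc.2 ht)),
      Real.mul_self_sqrt (show 0 ≤ 2 * κ * Ir by positivity), Real.sqrt_nonneg (q t₀),
      Real.sqrt_nonneg (2 * κ * Ir)]
  have hMle : M ≤ 2 * κ * Ia + B := by
    by_contra hcon
    push Not at hcon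
    have hC0 : 0 ≤ 2 * κ * Ia + B := add_nonneg (by positivity) hB0
    have hMpos : 0 < M := hC0.trans_lt hcon
    nlinarith [mul_lt_mul_of_pos_right hcon hMpos, hkey, hBsq, mul_le_mul_of_nonneg_left (le_of_lt
      ((le_add_of_nonneg_left (by positivity : 0 ≤ 2 * κ * Ia)).trans_lt hcon)) hB0]
  calc Real.sqrt (q t₁) ≤ M := hle t₁ (right_mem_Icc.2 ht)
    _ ≤ 2 * κ * Ia + B := hMle
    _ = Real.sqrt (q t₀) + 2 * κ * Ia + Real.sqrt (2 * κ * Ir) := by rw [hB]; ring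

/-- **Cauchy–Schwarz in time**: `(∫_{t₀}^{t₁} g)² ≤ (t₁ − t₀) ∫_{t₀}^{t₁} g²` for `g` continuous on `[t₀,t₁]`.
[folklore] -/
theorem sq_intervalIntegral_le {g : ℝ → ℝ} {t₀ t₁ : ℝ} (ht : t₀ ≤ t₁) (hg : ContinuousOn g (Icc t₀ t₁)) :
    (∫ t in t₀..t₁, g t) ^ 2 ≤ (t₁ - t₀) * ∫ t in t₀..t₁, g t ^ 2 := by
  -- `0 ≤ ∫ (g - m)²` with `m` the mean is the slick route; we use `2 g(t) I ≤ τ g(t)² + I²/τ`-free algebra instead: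
  -- for every real `λ`, `0 ≤ ∫ (λ g - 1)² = λ²∫g² - 2λ∫g + τ`.
  have hIg : IntervalIntegrable g volume t₀ t₁ := (hg.mono (by rw [uIcc_of_le ht])).intervalIntegrable
  have hg2c : ContinuousOn (fun t => g t ^ 2) (Icc t₀ t₁) := hg.pow 2
  have hIg2 : IntervalIntegrable (fun t => g t ^ 2) volume t₀ t₁ :=
    (hg2c.mono (by rw [uIcc_of_le ht])).intervalIntegrable
  set I := ∫ t in t₀..t₁, g t with hI
  set J := ∫ t in t₀..t₁, g t ^ 2 with hJ
  have hquad : ∀ l : ℝ, 0 ≤ l ^ 2 * J - 2 * l * I + (t₁ - t₀) := by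
    intro l
    have h0 : 0 ≤ ∫ t in t₀..t₁, (l * g t - 1) ^ 2 :=
      intervalIntegral.integral_nonneg ht fun t _ => sq_nonneg _
    have hexp : ∫ t in t₀..t₁, (l * g t - 1) ^ 2 = l ^ 2 * J - 2 * l * I + (t₁ - t₀) := by
      have e : (fun t => (l * g t - 1) ^ 2) = fun t => l ^ 2 * g t ^ 2 - 2 * l * g t + 1 := by
        funext t; ring
      rw [e, intervalIntegral.integral_add ((hIg2.const_mul _).sub (hIg.const_mul _))
        (intervalIntegrable_const), intervalIntegral.integral_sub (hIg2.const_mul _) (hIg.const_mul _),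
        intervalIntegral.integral_const_mul, intervalIntegral.integral_const_mul, intervalIntegral.integral_const]
      simp only [smul_eq_mul, mul_one, hI, hJ]
    linarith
  have hJ0 : 0 ≤ J := intervalIntegral.integral_nonneg ht fun t _ => sq_nonneg _
  by_cases hJz : J = 0
  · -- then `I = 0` as well (test the quadratic inequality at `l = (τ+1)/(2I)`), so the claim is `0 ≤ τ · 0`
    have hI0 : I = 0 := by
      by_contra hIne
      have h := hquad ((t₁ - t₀ + 1) / (2 * I))
      have e : ((t₁ - t₀ + 1) / (2 * I)) ^ 2 * J - 2 * ((t₁ - t₀ + 1) / (2 * I)) * I + (t₁ - t₀) = -1 := by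
        rw [hJz]; field_simp; ring
      linarith
    rw [hI0, hJz]; simp
  · have hJpos : 0 < J := lt_of_le_of_ne hJ0 (Ne.symm hJz)
    have := hquad (I / J)
    have e : (I / J) ^ 2 * J - 2 * (I / J) * I + (t₁ - t₀) = (t₁ - t₀) - I ^ 2 / J := by
      field_simp; ring
    rw [e] at this
    have : I ^ 2 / J ≤ t₁ - t₀ := by linarith
    rwa [div_le_iff₀ hJpos] at this


/-! ## §2 Pointwise and `L²` bookkeeping for the localised field `F = X(x_j)·G` -/

/-- `∫ (G_t)² = ‖θ(t)‖²` for the pull-back `G_t = θ(t) ∘ Φ_t` (measure-preserving shear). [folklore] -/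
theorem integral_moved_sq_eq (hij : i ≠ j) (θ : ℝ → UnitAddTorus (Fin 2) → ℝ) (P : ShearProfile) (Γ : ℝ → ℝ)
    (t : ℝ) : ∫ x, moved θ i j P (-Γ) t x ^ 2 = FluidPDE.Torus.scalarL2Sq (θ t) := by
  rw [FluidPDE.Torus.scalarL2Sq, moved_neg_apply]
  exact integral_comp_shearMap hij (amp P (-Γ t)) (fun x => θ t x ^ 2)

/-- **`L²` bounds for the localised field.** With `F = X(x_j)·G`, `|X| ≤ 1`, `|X'| ≤ C₁`, `|c| ≤ γ`,
`X ≠ 0 ∨ X' ≠ 0 → |Q − σ| ≤ ε₁`:  `∫(∂ᵢF)² ≤ ∫(∂ᵢG)²` and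
`∫(∂ⱼF − cσ∂ᵢF)² ≤ 3(∫(D̄G)² + C₁²∫G² + γ²ε₁²∫(∂ᵢG)²)`, `D̄ = ∂ⱼ − cQ(x_j)∂ᵢ`. [folklore] -/
theorem integral_loc_sq_le (hij : i ≠ j) (Q X Xd : ShearProfile) (hXd : ∀ y, Xd y = deriv X y)
    {c γ σ ε₁ C₁ : ℝ} (hε₁ : 0 ≤ ε₁) (hcγ : |c| ≤ γ) (hX1 : ∀ y, |X y| ≤ 1) (hC₁ : ∀ y, |Xd y| ≤ C₁)
    (hflat : ∀ y, X y ≠ 0 ∨ Xd y ≠ 0 → |Q y - σ| ≤ ε₁) {G : UnitAddTorus (Fin 2) → ℝ} (hG : IsSmooth G) :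
    (∫ x, partialDeriv i (fun x : UnitAddTorus (Fin 2) => X.onCircle (x j) * G x) x ^ 2 ≤
        ∫ x, partialDeriv i G x ^ 2) ∧
      (∫ x, (partialDeriv j (fun x : UnitAddTorus (Fin 2) => X.onCircle (x j) * G x) x -
          c * σ * partialDeriv i (fun x : UnitAddTorus (Fin 2) => X.onCircle (x j) * G x) x) ^ 2 ≤
        3 * ((∫ x, (partialDeriv j G x - c * Q.onCircle (x j) * partialDeriv i G x) ^ 2) +
          C₁ ^ 2 * (∫ x, G x ^ 2) + γ ^ 2 * ε₁ ^ 2 * ∫ x, partialDeriv i G x ^ 2)) := by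
  have hdi : ∀ x, partialDeriv i (fun x : UnitAddTorus (Fin 2) => X.onCircle (x j) * G x) x =
      X.onCircle (x j) * partialDeriv i G x := fun x => partialDeriv_i_onCircle_mul hij X hG x
  have hdj : ∀ x, partialDeriv j (fun x : UnitAddTorus (Fin 2) => X.onCircle (x j) * G x) x =
      X.onCircle (x j) * partialDeriv j G x + Xd.onCircle (x j) * G x := fun x => by
    rw [partialDeriv_j_onCircle_mul X hG x, partialDeriv_onCircle_comp_eq X Xd hXd]
  have hXb : ∀ x : UnitAddTorus (Fin 2), |X.onCircle (x j)| ≤ 1 := fun x => by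
    obtain ⟨y, rfl⟩ := proj_surjective x; rw [proj_apply, ShearProfile.onCircle_coe]; exact hX1 _
  have hXdb : ∀ x : UnitAddTorus (Fin 2), |Xd.onCircle (x j)| ≤ C₁ := fun x => by
    obtain ⟨y, rfl⟩ := proj_surjective x; rw [proj_apply, ShearProfile.onCircle_coe]; exact hC₁ _
  have hC₁0 : 0 ≤ C₁ := (abs_nonneg _).trans (hC₁ 0)
  have hγ0 : 0 ≤ γ := (abs_nonneg _).trans hcγ
  have hres : ∀ x : UnitAddTorus (Fin 2), |c * (X.onCircle (x j) * (Q.onCircle (x j) - σ))| ≤ γ * ε₁ := fun x => by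
    obtain ⟨y, rfl⟩ := proj_surjective x
    rw [proj_apply, ShearProfile.onCircle_coe, ShearProfile.onCircle_coe, abs_mul]
    by_cases hy : X (y j) = 0
    · rw [hy, zero_mul, abs_zero, mul_zero]; exact mul_nonneg hγ0 hε₁
    · rw [abs_mul]
      have h1 := hflat (y j) (Or.inl hy)
      calc |c| * (|X (y j)| * |Q (y j) - σ|) ≤ γ * (1 * ε₁) :=
            mul_le_mul hcγ (mul_le_mul (hX1 _) h1 (abs_nonneg _) zero_le_one)
              (mul_nonneg (abs_nonneg _) (abs_nonneg _)) hγ0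
        _ = γ * ε₁ := by ring
  have hDG : IsSmooth (fun x : UnitAddTorus (Fin 2) => partialDeriv j G x - c * Q.onCircle (x j) * partialDeriv i G x) :=
    isSmooth_slotDeriv Q c hG
  refine ⟨?_, ?_⟩
  · have hiG2 : IsSmooth (fun x => partialDeriv i G x ^ 2) := (hG.partialDeriv i).pow 2
    refine integral_mono_of_nonneg (Eventually.of_forall fun x => sq_nonneg _) hiG2.integrable
      (Eventually.of_forall fun x => ?_)
    simp only [hdi, mul_pow]
    have : X.onCircle (x j) ^ 2 ≤ 1 := by
      have := hXb x; rw [← sq_abs]; nlinarith [abs_nonneg (X.onCircle (x j))]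
    nlinarith [sq_nonneg (partialDeriv i G x)]
  · have hsum : IsSmooth (fun x => 3 * ((partialDeriv j G x - c * Q.onCircle (x j) * partialDeriv i G x) ^ 2 +
        C₁ ^ 2 * G x ^ 2 + γ ^ 2 * ε₁ ^ 2 * partialDeriv i G x ^ 2)) :=
      (isSmooth_const _).mul (((hDG.pow 2).add ((isSmooth_const _).mul (hG.pow 2))).add
        ((isSmooth_const _).mul ((hG.partialDeriv i).pow 2)))
    have hrhs : 3 * ((∫ x, (partialDeriv j G x - c * Q.onCircle (x j) * partialDeriv i G x) ^ 2) +
          C₁ ^ 2 * (∫ x, G x ^ 2) + γ ^ 2 * ε₁ ^ 2 * ∫ x, partialDeriv i G x ^ 2) =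
        ∫ x, 3 * ((partialDeriv j G x - c * Q.onCircle (x j) * partialDeriv i G x) ^ 2 +
          C₁ ^ 2 * G x ^ 2 + γ ^ 2 * ε₁ ^ 2 * partialDeriv i G x ^ 2) := by
      have i1 : IsSmooth (fun x : UnitAddTorus (Fin 2) =>
          (partialDeriv j G x - c * Q.onCircle (x j) * partialDeriv i G x) ^ 2) := hDG.pow 2
      have i2 : IsSmooth (fun x : UnitAddTorus (Fin 2) => C₁ ^ 2 * G x ^ 2) := (isSmooth_const _).mul (hG.pow 2)
      have i3 : IsSmooth (fun x : UnitAddTorus (Fin 2) => γ ^ 2 * ε₁ ^ 2 * partialDeriv i G x ^ 2) :=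
        (isSmooth_const _).mul ((hG.partialDeriv i).pow 2)
      have i12 : IsSmooth (fun x : UnitAddTorus (Fin 2) =>
          (partialDeriv j G x - c * Q.onCircle (x j) * partialDeriv i G x) ^ 2 + C₁ ^ 2 * G x ^ 2) := i1.add i2
      rw [integral_const_mul, integral_add i12.integrable i3.integrable,
        integral_add i1.integrable i2.integrable, integral_const_mul, integral_const_mul]
    rw [hrhs]
    refine integral_mono_of_nonneg (Eventually.of_forall fun x => sq_nonneg _) hsum.integrable
      (Eventually.of_forall fun x => ?_)
    simp only [hdi, hdj]
    have e : X.onCircle (x j) * partialDeriv j G x + Xd.onCircle (x j) * G x -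
        c * σ * (X.onCircle (x j) * partialDeriv i G x) =
        X.onCircle (x j) * (partialDeriv j G x - c * Q.onCircle (x j) * partialDeriv i G x) +
          Xd.onCircle (x j) * G x + c * (X.onCircle (x j) * (Q.onCircle (x j) - σ)) * partialDeriv i G x := by ring
    rw [e]
    have h3sq : ∀ a b c : ℝ, (a + b + c) ^ 2 ≤ 3 * (a ^ 2 + b ^ 2 + c ^ 2) := fun a b c => by
      nlinarith [sq_nonneg (a - b), sq_nonneg (b - c), sq_nonneg (a - c)]
    refine (h3sq _ _ _).trans ?_
    have b1 : (X.onCircle (x j) * (partialDeriv j G x - c * Q.onCircle (x j) * partialDeriv i G x)) ^ 2 ≤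
        (partialDeriv j G x - c * Q.onCircle (x j) * partialDeriv i G x) ^ 2 := by
      rw [mul_pow]
      have : X.onCircle (x j) ^ 2 ≤ 1 := by
        have := hXb x; rw [← sq_abs]; nlinarith [abs_nonneg (X.onCircle (x j))]
      nlinarith [sq_nonneg (partialDeriv j G x - c * Q.onCircle (x j) * partialDeriv i G x)]
    have b2 : (Xd.onCircle (x j) * G x) ^ 2 ≤ C₁ ^ 2 * G x ^ 2 := by
      rw [mul_pow, ← sq_abs (Xd.onCircle (x j))]
      exact mul_le_mul_of_nonneg_right (pow_le_pow_left₀ (abs_nonneg _) (hXdb x) 2) (sq_nonneg _)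
    have b3 : (c * (X.onCircle (x j) * (Q.onCircle (x j) - σ)) * partialDeriv i G x) ^ 2 ≤
        γ ^ 2 * ε₁ ^ 2 * partialDeriv i G x ^ 2 := by
      have h3 := pow_le_pow_left₀ (abs_nonneg _) (hres x) 2
      rw [sq_abs] at h3
      calc (c * (X.onCircle (x j) * (Q.onCircle (x j) - σ)) * partialDeriv i G x) ^ 2
          = (c * (X.onCircle (x j) * (Q.onCircle (x j) - σ))) ^ 2 * partialDeriv i G x ^ 2 := by ring
        _ ≤ (γ * ε₁) ^ 2 * partialDeriv i G x ^ 2 := mul_le_mul_of_nonneg_right h3 (sq_nonneg _)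
        _ = γ ^ 2 * ε₁ ^ 2 * partialDeriv i G x ^ 2 := by ring
    linarith

end SlotLemma

end Summit.AnomalousDissipation.AnomalousDissipation.Theorems.SawtoothPulseCascade.K1Slot
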